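import Summits.CriticalPhenomena.PercolationContinuityZ3.Theorems.SahiMasterFamilySandwich

/-!
# Closure of the zero-flag class under an independent event (every order)

Unit `prim-master-conj` (crux anchor stmt-CriticalPhenomena-4575); companion of `SahiMasterFamily.lean` (the class `Z_k = SuppZeroFlag k`) and
`SahiMasterFamilyZeroFamilies.lean`.  Two purely combinatorial facts about the recursive zero-flag class, at EVERY order, used throughout
the all-order programme (ALLK-NOTES of the unit, "Lemma I" / "Lemma L"):
* `suppZeroFlag_update_inter_of_disjoint` (Lemma I): if `U ∈ Z_k` (increasing events) and the increasing event `A` shares no essential coordinate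
  with any member of `U`, then intersecting any one member with `A` keeps the family in `Z_k` (induction along the certificate: the base is
  `esupp(U_t ∩ A) ⊆ esupp U_t ∪ esupp A`);
* `suppZeroFlag_of_zeroFlag_succAbove_of_disjoint` (Lemma L): consequently a family whose members off one slot `s` form a zero flag and whose
  member `U_s` shares no essential coordinate with the others lies in `Z_{k+1}` (peel at `s`; the modified families are Lemma I).
By `sahiE_ind_eq_zero_of_suppZeroFlag` both give `E_k ≡ 0` for the families concerned.  No conjecture asserted; axioms standard. [this work]
-/

noncomputable section

open scoped Classical

namespace Summit.CriticalPhenomena.PercolationContinuityZ3.Theorems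

open Finset Function
open Literature.Combinatorics.Sahi2008
open Literature.Probability.Percolation (DeterminedBy)

variable {ι : Type*} [Fintype ι]

/-- Essential supports of an intersection with an event independent of a family stay independent of that event. [folklore] -/
theorem disjoint_esupp_inter_of_disjoint {A B C : Set (Set ι)} (hB : Disjoint (esupp A) (esupp B)) (hC : Disjoint (esupp A) (esupp C)) :
    Disjoint (esupp A) (esupp (B ∩ C)) :=
  Finset.disjoint_of_subset_right (esupp_inter_subset B C) (Finset.disjoint_union_right.2 ⟨hB, hC⟩)

/-- **Lemma I — `Z_k` is closed under intersecting one member with an independent event** (every order): for increasing events `U_j` and an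
increasing event `A` with `esupp A ∩ esupp U_j = ∅` for all `j`, `U ∈ Z_k ⇒ (U with U_t ↦ U_t ∩ A) ∈ Z_k`. [this work] -/
theorem suppZeroFlag_update_inter_of_disjoint :
    ∀ (k : ℕ) (U : Fin k → Set (Set ι)), (∀ j, IsUpperSet (U j)) → ∀ (A : Set (Set ι)), IsUpperSet A →
      (∀ j, Disjoint (esupp A) (esupp (U j))) → ∀ t : Fin k, SuppZeroFlag k U → SuppZeroFlag k (update U t (U t ∩ A))
  | 0, _, _, _, _, _, t, _ => t.elim0
  | 1, U, _, A, _, _, t, h => by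
    have ht : t = 0 := Fin.eq_zero t
    subst ht
    show update U 0 (U 0 ∩ A) 0 = ∅
    rw [update_self, show U 0 = ∅ from h, Set.empty_inter]
  | 2, U, hU, A, hA, hd, t, h => by
    rw [suppZeroFlag_two_eta, suppZeroFlag_two_iff (hU 0) (hU 1)] at h
    rw [suppZeroFlag_two_eta]
    rcases Fin.exists_fin_two.1 ⟨t, rfl⟩ with ht | ht
    · subst ht
      rw [update_self, update_of_ne (show (1 : Fin 2) ≠ 0 by decide),
        suppZeroFlag_two_iff ((hU 0).inter hA) (hU 1)]
      exact Finset.disjoint_of_subset_left (esupp_inter_subset _ _) (Finset.disjoint_union_left.2 ⟨h, hd 1⟩)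
    · subst ht
      rw [update_self, update_of_ne (show (0 : Fin 2) ≠ 1 by decide),
        suppZeroFlag_two_iff (hU 0) ((hU 1).inter hA)]
      exact Finset.disjoint_of_subset_right (esupp_inter_subset _ _) (Finset.disjoint_union_right.2 ⟨h, (hd 0).symm⟩)
  | k + 3, U, hU, A, hA, hd, t, ⟨i, h0, hl⟩ => by
    -- plumbing: the families met in the recursion are increasing and independent of `A`
    have hUi : ∀ j, IsUpperSet (U (i.succAbove j)) := fun j => hU _
    have hdi : ∀ j, Disjoint (esupp A) (esupp (U (i.succAbove j))) := fun j => hd _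
    have hUl : ∀ l j, IsUpperSet (update (fun j => U (i.succAbove j)) l (U (i.succAbove l) ∩ U i) j) := by
      intro l j
      by_cases hj : j = l
      · subst hj; rw [update_self]; exact (hU _).inter (hU i)
      · rw [update_of_ne hj]; exact hU _
    have hdl : ∀ l j, Disjoint (esupp A) (esupp (update (fun j => U (i.succAbove j)) l (U (i.succAbove l) ∩ U i) j)) := by
      intro l j
      by_cases hj : j = l
      · subst hj; rw [update_self]; exact disjoint_esupp_inter_of_disjoint (hd _) (hd i)
      · rw [update_of_ne hj]; exact hd _
    by_cases hti : t = i
    · -- the peeled member itself is intersected with `A`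
      subst i
      refine ⟨t, ?_, fun l => ?_⟩
      · have e : (fun j => update U t (U t ∩ A) (t.succAbove j)) = fun j => U (t.succAbove j) := by
          funext j; exact update_of_ne (Fin.succAbove_ne t j) _ _
        rw [e]; exact h0
      · have e : update (fun j => update U t (U t ∩ A) (t.succAbove j)) l
            (update U t (U t ∩ A) (t.succAbove l) ∩ update U t (U t ∩ A) t) =
            update (update (fun j => U (t.succAbove j)) l (U (t.succAbove l) ∩ U t)) l
              (update (fun j => U (t.succAbove j)) l (U (t.succAbove l) ∩ U t) l ∩ A) := by
          funext j
          by_cases hj : j = l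
          · subst hj
            simp only [update_self, update_of_ne (Fin.succAbove_ne t j)]
            exact (Set.inter_assoc _ _ _).symm
          · simp only [update_of_ne hj, update_of_ne (Fin.succAbove_ne t j)]
        rw [e]
        exact suppZeroFlag_update_inter_of_disjoint (k + 2) _ (hUl l) A hA (hdl l) l (hl l)
    · -- another member is intersected with `A`: `t = i.succAbove t'`
      obtain ⟨t', ht'⟩ := Fin.exists_succAbove_eq hti
      subst ht'
      have hne : ∀ {j : Fin (k + 2)}, j ≠ t' → i.succAbove j ≠ i.succAbove t' :=
        fun hj h => hj (Fin.succAbove_right_injective h)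
      refine ⟨i, ?_, fun l => ?_⟩
      · have e : (fun j => update U (i.succAbove t') (U (i.succAbove t') ∩ A) (i.succAbove j)) =
            update (fun j => U (i.succAbove j)) t' (U (i.succAbove t') ∩ A) := by
          funext j
          by_cases hj : j = t'
          · subst hj; simp only [update_self]
          · simp only [update_of_ne hj, update_of_ne (hne hj)]
        rw [e]
        exact suppZeroFlag_update_inter_of_disjoint (k + 2) _ hUi A hA hdi t' h0
      · have e : update (fun j => update U (i.succAbove t') (U (i.succAbove t') ∩ A) (i.succAbove j)) l
            (update U (i.succAbove t') (U (i.succAbove t') ∩ A) (i.succAbove l) ∩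
              update U (i.succAbove t') (U (i.succAbove t') ∩ A) i) =
            update (update (fun j => U (i.succAbove j)) l (U (i.succAbove l) ∩ U i)) t'
              (update (fun j => U (i.succAbove j)) l (U (i.succAbove l) ∩ U i) t' ∩ A) := by
          funext j
          have hi : update U (i.succAbove t') (U (i.succAbove t') ∩ A) i = U i :=
            update_of_ne (Fin.succAbove_ne i t').symm _ _
          by_cases hjl : j = l
          · subst hjl
            by_cases hjt : j = t'
            · subst hjt
              simp only [update_self, hi]
              exact Set.inter_right_comm _ _ _
            · simp only [update_self, update_of_ne hjt, update_of_ne (hne hjt), hi]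
          · by_cases hjt : j = t'
            · subst hjt
              simp only [update_self, update_of_ne hjl]
            · simp only [update_of_ne hjl, update_of_ne hjt, update_of_ne (hne hjt)]
        rw [e]
        exact suppZeroFlag_update_inter_of_disjoint (k + 2) _ (hUl l) A hA (hdl l) t' (hl l)

/-- **Lemma L — a zero flag plus an independent event is a zero flag** (every order `k + 3`): if the members of `U` off the slot `s` are increasing
and form a zero flag of order `k + 2`, and the increasing event `U_s` shares no essential coordinate with any of them, then `U ∈ Z_{k+3}` (via
the slot `s`). [this work] -/
theorem suppZeroFlag_of_zeroFlag_succAbove_of_disjoint {k : ℕ} (U : Fin (k + 3) → Set (Set ι)) (s : Fin (k + 3))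
    (hU : ∀ j, IsUpperSet (U j)) (hZ : SuppZeroFlag (k + 2) (fun j => U (s.succAbove j)))
    (hd : ∀ j, Disjoint (esupp (U s)) (esupp (U (s.succAbove j)))) : SuppZeroFlag (k + 3) U :=
  ⟨s, hZ, fun l => suppZeroFlag_update_inter_of_disjoint (k + 2) _ (fun _ => hU _) (U s) (hU s) hd l hZ⟩

/-- **`E_{k+3} = 0` for a zero flag plus an independent event** (every `p ∈ [0,1]^ι`). [this work] -/
theorem sahiE_ind_eq_zero_of_zeroFlag_succAbove_of_disjoint (p : ι → unitInterval) {k : ℕ} (U : Fin (k + 3) → Set (Set ι))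
    (s : Fin (k + 3)) (hU : ∀ j, IsUpperSet (U j)) (hZ : SuppZeroFlag (k + 2) (fun j => U (s.succAbove j)))
    (hd : ∀ j, Disjoint (esupp (U s)) (esupp (U (s.succAbove j)))) :
    sahiE (bernoulliWeight p) (k + 3) (fun j => Literature.Probability.Percolation.DecisionTree.ind (U j)) = 0 :=
  sahiE_ind_eq_zero_of_suppZeroFlag p (suppZeroFlag_of_zeroFlag_succAbove_of_disjoint U s hU hZ hd)

end Summit.CriticalPhenomena.PercolationContinuityZ3.Theorems
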